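import Mathlib
import Literature.Analysis.FluidPDE.NSWave0
import Literature.Analysis.FluidPDE.ClassicalSolution
import HarnessLib

/-!
# Claim skeleton (D-0090 NS-CLAIMS, C110): Strelzoff–Strelzoff 2026, Zenodo 19633271 v2 — «NS global regularity on ℝ³, machine-verified» (Lean-artefact row)

Typed skeleton (T2-low QUICK, C81 treatment; lead ruling 2026-08-26T21:07:21Z) of Andrew Strelzoff and
Benjamin Strelzoff, *Navier-Stokes Global Regularity on ℝ³: A Machine-Verified Proof via Three Rings
Koopman-Beltrami Sector Analysis on the Hopf Fibration*, Zenodo record 19633271 (DOI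
10.5281/zenodo.19633271), **v2 of 2026-04-17 = version of record** (bib `StrelzoffStrelzoff2026NSHopf`).
Sources `pub/ns-claims/sources/Strelzoff2026/`: the paper `ns_regularity_v4.md` (locators «md l.N»; lit-4
`LOCATORS.md` of record, lit-1 `LIT1-NOTES.md`) and the Lean artefact `SafeZoneNN_Spectral.zip` (38 files,
9 450 lines, `Spectral/**`; NO lakefile / toolchain / manifest; not built here; locators «File.lean:N» of the
extracted tree). UNREFEREED CLAIM under adjudication — NOTHING in this file asserts a statement of the paper
about Navier–Stokes: the paper's statements are `def … : Prop`; the `theorem`s are kernel facts about them.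
The artefact's code is NOT imported: its capstone TYPES are transcribed over its own constants re-declared as
PARAMETERS (structures `CapstoneData`, `FiniteTypeData`). Card `pub/ns-claims/claims/Strelzoff2026/CARD.md`
(PREDICTION §4 frozen 21:2xZ); refuter-8, ref-4, lit-4, writer-2.

## The claimed statement

Abstract (md l.26): «We prove that for any viscosity `ν > 0` and any smooth, finite-energy, divergence-free
initial data on ℝ³, the incompressible Navier-Stokes equations admit a smooth solution with bounded energy
for all time. The proof is machine-verified: 358 Lean 4 theorems with zero uses of `sorry`.» —
`ClaimedTheorem` (the (A)-type sentence over the tree's `IsClassicalNSSolutionOn`; data class "smooth,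
finite-energy, divergence-free" ⊋ Clay (4): (A)-STRONGER on Δ4).

## What the artefact proves (transcribed) and the printed bridge

* **Theorem 11.1 / `navier_stokes_regular`** (md §11.1 l.1031–1039, §11.2 l.1041–1054 =
  `Spectral/NSRegularityComplete.lean:214`): for `nsr : NSRegularityTheorem n` — a record of caller-supplied
  data: `couplingConst > 0` (`CGCouplingBound`, CGCoupling.lean:147), `weight : ℕ → ℝ` with
  `weight m = m + 1` (`WignerConformalCert`, WignerBeltrami.lean:95), sector radii `sectorRho : Fin nSectors → ℝ`
  with the FIELD `rho_from_leray : ∀ k, sectorRho k ≤ 1` (`NSBeltramiDecomp`, KoopmanGronwall.lean:201–214),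
  `suppressionRate = aperyConstant := 1.202056903` (CasimirSuppression.lean:69, :93–97), `nu > 0`,
  `initialEnergy > 0` — the conjunction (a) `∃ kCrit, ∀ k > kCrit, couplingConst·(k+1) < nu·(k+1)²`,
  (b) `globallyStable := ∀ k, sectorRho k ≤ 1`, (c) `∀ k ≥ 1, 3/2 < weight k`, (d)
  `∀ k ≥ 1, exp(−rate·k²) ≤ 1`. Transcribed as `CapstoneStatement (D : CapstoneData)` and RE-PROVED here
  (`capstone_holds`, 25 lines of real arithmetic): the artefact's theorem is TRUE and mentions no velocity
  field, equation, datum, time or smoothness notion (no `Mathlib.Analysis.Calculus`/measure import occurs in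
  the artefact; lit-4 §2).
* **The bridge** (md §1.6 l.166: «Not formalized (standard PDE theory): the promotion from energy bounds to
  smooth solutions via Ladyzhenskaya-Prodi-Serrin criteria»; NSRegularityComplete.lean:240–262 comment
  «Together these give: energy bounded for all time → regularity») — `Step_bridge`: "Theorem 11.1 for all
  oracle data ⇒ the abstract's sentence". Kernel fact `step_bridge_iff_claimedTheorem`: since the capstone
  holds for every datum, the bridge is EQUIVALENT to `ClaimedTheorem` — the entire Navier–Stokes content of the
  claim sits in the unformalized sentence.
* **v2 supplement capstone `finiteType_regularity`** (`Spectral/FiniteType/GalerkinLimit.lean:75`):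
  `(u₀ : R3VelocityField) (C₀ : ℝ) (hC₀ : 0 < C₀) : ∃ u : R3VelocityField, isGlobalSmoothSolution u`, over
  `opaque R3VelocityField : Type` (Stereographic.lean:59), `axiom criticalNorm`, `axiom isGlobalSmoothSolution :
  R3VelocityField → Prop`, `axiom nielsen_critical_estimate` (CriticalEstimate.lean:41–57), `axiom
  galerkin_compactness` (GalerkinLimit.lean:60) and the proved `uniform_chain_contractivity`. Transcribed over
  PARAMETERS `F : FiniteTypeData` (the opaque type and the axiomatised symbols as fields; nothing assumed about
  them): the two NS-carrying axioms as `Axiom_galerkinCompactness F`, `Axiom_nielsenCriticalEstimate F`; the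
  artefact's 3-line proof re-run as `finiteTypeCapstone_of_axioms`; kernel fact `finiteTypeCapstone_iff`: the
  capstone's content is "`R3VelocityField` nonempty ⇒ some `u` satisfies the uninterpreted predicate" (the
  witness is not linked to `u₀`). Its bridge to the abstract's sentence: `Step_bridgeFT`.
* Census (lit-4/lit-1, lake-free): `sorry` 0 · `opaque` 2 · `axiom` 19 (all in `FiniteType/`, `Nielsen/`:
  Stereographic.lean:54–83 incl. `stereographic_solvesNS_iff (u) : Prop` + `nielsen_stereographic_theorem_3_1 :
  stereographic_solvesNS_iff u` and `stereographicPullback_smooth : True -- placeholder`; UniversalBound :55;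
  GalerkinLimit :60; OperatorBound :64–68; CriticalEstimate :41–54; Coupling :61–75; VanDerCorput :49–54) vs
  md §1.6 l.162 «no `axiom` declarations beyond Lean's foundations» (true of the 14 core files of §1–§11).

COMPOSITION: `claim_of_steps : Step_bridge → ClaimedTheorem` (with `capstone_holds`), and
`claim_of_steps_v2 (F) : Axiom_galerkinCompactness F → Axiom_nielsenCriticalEstimate F → Step_bridgeFT F →
ClaimedTheorem`. Pure logic.

WHAT THIS IS NOT: not a claim about NS regularity or blow-up; not a claim about any author beyond the typed
locator.
-/

open scoped ENNReal
open _root_.MeasureTheory _root_.Set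

namespace Literature.Claims.NS.Strelzoff2026

open Literature.Analysis.FluidPDE

noncomputable section

/-- Physical space `ℝ³`. [folklore] -/
abbrev E3 : Type := EuclideanSpace ℝ (Fin 3)

/-! ## A. The claimed statement (abstract, md l.26) over the tree's notions -/

/-- **The abstract's sentence** (md l.26): «for any viscosity `ν > 0` and any smooth, finite-energy,
divergence-free initial data on ℝ³, the incompressible Navier-Stokes equations admit a smooth solution with
bounded energy for all time» — a global classical solution (`IsClassicalNSSolutionOn (Ici 0)`, `f ≡ 0`) from
`u₀` with `sup_t ‖u(t)‖_{L²} < ∞`. [claim: StrelzoffStrelzoff2026NSHopf, status: under-review] -/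
def ClaimedTheorem : Prop :=
  ∀ ν : ℝ, 0 < ν → ∀ u₀ : E3 → E3, ContDiff ℝ (⊤ : ℕ∞) u₀ → MemLp u₀ 2 (volume : Measure E3) →
    NSWave0.IsDivFree u₀ →
    ∃ (u : ℝ → E3 → E3) (p : ℝ → E3 → ℝ), IsClassicalNSSolutionOn (Ici 0) ν 0 u p ∧ u 0 = u₀ ∧
      ∃ E : ℝ, ∀ t ∈ Ici (0 : ℝ), MemLp (u t) 2 (volume : Measure E3) ∧
        (eLpNorm (u t) 2 (volume : Measure E3)).toReal ≤ E

/-! ## B. The artefact's capstone `navier_stokes_regular`, transcribed over parameters -/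

/-- **The data of `NSRegularityTheorem n`** (NSRegularityComplete.lean:120–134) that the capstone's TYPE
mentions, re-declared as parameters (the artefact is not imported): `couplingConst` (`CGCouplingBound`,
CGCoupling.lean:147–157), `weight` with `weight_eq` (`WignerConformalCert`, WignerBeltrami.lean:95–101),
`nSectors`, `sectorRho` with `rho_pos` (`BeltramiDecomp`, BeltramiDecomposition.lean:54–66) and the FIELD
`rho_from_leray : ∀ k, sectorRho k ≤ 1` (`NSBeltramiDecomp`, KoopmanGronwall.lean:201–214: «The ρ_k ≤ 1 from
bounded energy (Leray consequence)» — entered as data), `suppressionRate` with `rate_pos`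
(`CasimirSuppressionCert`, CasimirSuppression.lean:93–99; there `rate_eq : suppressionRate = aperyConstant`
with `aperyConstant := 1.202056903`, l.69), `nu > 0`, `initialEnergy > 0`. Other fields (winding numbers,
Galerkin projection, `LerayDissipation.couplingConservesEnergy : Prop` with its own proof field, spectrum)
do not occur in the capstone's type. [cite: StrelzoffStrelzoff2026NSHopf, Spectral/NSRegularityComplete.lean:120–134] -/
structure CapstoneData where
  /-- `CGCouplingBound.couplingConst` (M). -/
  couplingConst : ℝ
  coupling_pos : 0 < couplingConst
  /-- `WignerConformalCert.weight`. -/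
  weight : ℕ → ℝ
  weight_eq : ∀ m, weight m = (m : ℝ) + 1
  /-- `BeltramiDecomp.nSectors`. -/
  nSectors : ℕ
  /-- `BeltramiDecomp.sectorRho`. -/
  sectorRho : Fin nSectors → ℝ
  rho_pos : ∀ k, 0 < sectorRho k
  /-- `NSBeltramiDecomp.rho_from_leray` — conjunct (b) of the capstone IS this field. -/
  rho_from_leray : ∀ k, sectorRho k ≤ 1
  /-- `CasimirSuppressionCert.suppressionRate` (= `1.202056903` in the artefact). -/
  suppressionRate : ℝ
  rate_pos : 0 < suppressionRate
  /-- viscosity `nu`. -/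
  nu : ℝ
  nu_pos : 0 < nu
  /-- `initialEnergy`. -/
  initialEnergy : ℝ
  initialEnergy_pos : 0 < initialEnergy

/-- `cgTotalCoupling cgb k := cgb.couplingConst * (k + 1)` (CGCoupling.lean:163). [cite: StrelzoffStrelzoff2026NSHopf, Spectral/CGCoupling.lean:163] -/
def cgTotalCoupling (D : CapstoneData) (k : ℕ) : ℝ := D.couplingConst * ((k : ℝ) + 1)

/-- `dissipationRate nu k := nu * (k + 1) ^ 2` (BlaschkeCoupling.lean:147). [cite: StrelzoffStrelzoff2026NSHopf, Spectral/BlaschkeCoupling.lean:147] -/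
def dissipationRate (nu : ℝ) (k : ℕ) : ℝ := nu * ((k : ℝ) + 1) ^ 2

/-- `BeltramiDecomp.globallyStable bd := ∀ k, bd.sectorRho k ≤ 1` (BeltramiDecomposition.lean:69–74).
[cite: StrelzoffStrelzoff2026NSHopf, Spectral/BeltramiDecomposition.lean:73] -/
def globallyStable (D : CapstoneData) : Prop := ∀ k, D.sectorRho k ≤ 1

/-- `r3IntegralConverges cert k := 3 / 2 < cert.weight k` (WignerBeltrami.lean:125; docstring: «The ℝ³ coupling
integral for sector k … Converges when weight(k) > 3/2»). [cite: StrelzoffStrelzoff2026NSHopf, Spectral/WignerBeltrami.lean:125] -/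
def r3IntegralConverges (D : CapstoneData) (k : ℕ) : Prop := 3 / 2 < D.weight k

/-- `suppressionFactor csc k := Real.exp (-(csc.suppressionRate * k ^ 2))` (CasimirSuppression.lean:103).
[cite: StrelzoffStrelzoff2026NSHopf, Spectral/CasimirSuppression.lean:103] -/
def suppressionFactor (D : CapstoneData) (k : ℕ) : ℝ := Real.exp (-(D.suppressionRate * (k : ℝ) ^ 2))

/-- **The TYPE of `navier_stokes_regular`** (NSRegularityComplete.lean:214–225 = md §11.2 l.1041–1054 =
printed Theorem 11.1 (a)–(d)), verbatim up to the parameter record: (a) ∧ (b) ∧ (c) ∧ (d).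
[claim: StrelzoffStrelzoff2026NSHopf, status: under-review] -/
def CapstoneStatement (D : CapstoneData) : Prop :=
  (∃ kCrit : ℕ, ∀ k, kCrit < k → cgTotalCoupling D k < dissipationRate D.nu k) ∧
    globallyStable D ∧
    (∀ k, 1 ≤ k → r3IntegralConverges D k) ∧
    (∀ k, 1 ≤ k → suppressionFactor D k ≤ 1)

/-- **The capstone holds for every datum** — re-proved here in 20 lines (the artefact's route:
`cg_kCrit_computable` CGCoupling.lean:232, `ns_globally_stable := rho_from_leray` KoopmanGronwall.lean:217,
`wigner_weight_converges` WignerBeltrami.lean:104, `suppression_le_one` CasimirSuppression.lean:107): real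
arithmetic about the record's fields; no Navier–Stokes object occurs. [cite: StrelzoffStrelzoff2026NSHopf, Spectral/NSRegularityComplete.lean:214–225] -/
theorem capstone_holds (D : CapstoneData) : CapstoneStatement D := by
  refine ⟨⟨Nat.ceil (D.couplingConst / D.nu), fun k hk => ?_⟩, D.rho_from_leray, fun k hk => ?_,
    fun k _ => ?_⟩
  · -- (a): M (k+1) < ν (k+1)² since M/ν < k + 1
    have hν := D.nu_pos
    have hk1 : (0 : ℝ) < (k : ℝ) + 1 := by positivity
    have hceil : D.couplingConst / D.nu ≤ (Nat.ceil (D.couplingConst / D.nu) : ℝ) := Nat.le_ceil _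
    have hlt : (Nat.ceil (D.couplingConst / D.nu) : ℝ) < (k : ℝ) := by exact_mod_cast hk
    have hM : D.couplingConst < D.nu * ((k : ℝ) + 1) := by
      have h1 : D.couplingConst / D.nu < (k : ℝ) + 1 := by linarith
      have h2 := (div_lt_iff₀ hν).1 h1
      linarith [h2]
    unfold cgTotalCoupling dissipationRate
    nlinarith [hM, hk1]
  · -- (c): weight k = k + 1 > 3/2 for k ≥ 1
    unfold r3IntegralConverges
    rw [D.weight_eq]
    have : (1 : ℝ) ≤ (k : ℝ) := by exact_mod_cast hk
    linarith
  · -- (d): exp (−rate k²) ≤ 1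
    unfold suppressionFactor
    rw [← Real.exp_zero]
    refine Real.exp_le_exp.2 ?_
    have : 0 ≤ D.suppressionRate * (k : ℝ) ^ 2 := mul_nonneg D.rate_pos.le (by positivity)
    linarith

/-- `CapstoneStatement` holds for all parameters — `_holds` alias of `capstone_holds` above under the fact's exact name
(appended 2026-08-28, D-0026 bookkeeping: the proof term is the existing theorem of this file; no statement,
definition or attribute is edited; no new named fact; the ledger's debt table listed the fact
unproved). [cite: StrelzoffStrelzoff2026NSHopf, Spectral/NSRegularityComplete.lean:214–225] -/
theorem _root_.Literature.Claims.NS.Strelzoff2026.CapstoneStatement_holds (D : CapstoneData) :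
    CapstoneStatement D :=
  _root_.Literature.Claims.NS.Strelzoff2026.capstone_holds D

/-- **THE BRIDGE** (md §1.6 l.166 «Not formalized (standard PDE theory): the promotion from energy bounds to
smooth solutions via Ladyzhenskaya-Prodi-Serrin criteria»; NSRegularityComplete.lean:240–262 «Together these
give: energy bounded for all time → regularity»; abstract l.26 «The proof is machine-verified»): Theorem 11.1
for every oracle datum ⇒ the abstract's sentence. [claim: StrelzoffStrelzoff2026NSHopf, status: under-review] -/
def Step_bridge : Prop :=
  (∀ D : CapstoneData, CapstoneStatement D) → ClaimedTheorem

/-- **Kernel fact: the bridge IS the claim.** Since `CapstoneStatement D` holds for every `D`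
(`capstone_holds`), `Step_bridge ↔ ClaimedTheorem`: the machine-checked part contributes nothing toward the
sentence of the abstract. [cite: StrelzoffStrelzoff2026NSHopf, md §1.6 l.158–166] -/
theorem step_bridge_iff_claimedTheorem : Step_bridge ↔ ClaimedTheorem :=
  ⟨fun h => h capstone_holds, fun h _ => h⟩

/-- **COMPOSITION (§1–§11 chain)**: bridge ⇒ claim (the capstone is discharged by `capstone_holds`). Pure
logic. [claim: StrelzoffStrelzoff2026NSHopf, status: under-review] -/
theorem claim_of_steps (h : Step_bridge) : ClaimedTheorem := h capstone_holds

/-! ## C. The v2 supplement capstone `finiteType_regularity`, transcribed over parameters -/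

/-- **The symbols of `Spectral/FiniteType/`** that `finiteType_regularity`'s TYPE and proof mention,
re-declared as parameters: the OPAQUE carrier `R3VelocityField : Type` (Stereographic.lean:59), the
axiomatised `criticalNorm : R3VelocityField → ℝ → ℝ` (CriticalEstimate.lean:41; docstring «‖u(t)‖_{L³} +
‖u(t)‖_{BMO⁻¹}. Axiomatized»), the axiomatised predicate `isGlobalSmoothSolution : R3VelocityField → Prop`
(:48), and the Prop `UniformChainContractivity` (GalerkinLimit.lean:46–48; PROVED in the artefact from the
numeric axioms `g_op_le_uniform`/`g_op_nonneg` OperatorBound.lean:64–68, `w3j_*` Coupling.lean:61–75,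
`phaseAvg_*` VanDerCorput.lean:49–54, `w3j_orthogonality_sum` UniversalBound.lean:55). Nothing is assumed about
them here. [cite: StrelzoffStrelzoff2026NSHopf, Spectral/FiniteType/CriticalEstimate.lean:41–57] -/
structure FiniteTypeData where
  /-- `opaque R3VelocityField : Type`. -/
  V : Type
  /-- `axiom criticalNorm`. -/
  criticalNorm : V → ℝ → ℝ
  /-- `axiom isGlobalSmoothSolution`. -/
  isGlobalSmoothSolution : V → Prop
  /-- `def UniformChainContractivity : Prop` (proved there: `uniform_chain_contractivity`). -/
  UniformChainContractivity : Prop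

/-- **`axiom galerkin_compactness`** (GalerkinLimit.lean:60–66), verbatim over the parameters: «If the
truncated Galerkin system satisfies uniform chain contractivity, there exists a Leray weak limit on ℝ³ whose
critical norm is bounded by a constant depending only on the initial data. This is the Aubin-Lions compactness
step, axiomatized here.» — NB the conclusion does not mention `u₀`. [claim: StrelzoffStrelzoff2026NSHopf, status: under-review] -/
def Axiom_galerkinCompactness (F : FiniteTypeData) : Prop :=
  ∀ (_u₀ : F.V) (C₀ : ℝ), 0 < C₀ → F.UniformChainContractivity →
    ∃ (u : F.V) (C : ℝ), 0 < C ∧ ∀ t : ℝ, 0 ≤ t → F.criticalNorm u t ≤ C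

/-- **`axiom nielsen_critical_estimate`** (CriticalEstimate.lean:54–57), verbatim over the parameters: «If the
critical norm of a Leray solution is uniformly bounded, the solution is globally smooth … we take it as an
axiom.» [claim: StrelzoffStrelzoff2026NSHopf, status: under-review] -/
def Axiom_nielsenCriticalEstimate (F : FiniteTypeData) : Prop :=
  ∀ (u : F.V) (C : ℝ), 0 < C → (∀ t : ℝ, 0 ≤ t → F.criticalNorm u t ≤ C) → F.isGlobalSmoothSolution u

/-- **`theorem uniform_chain_contractivity : UniformChainContractivity`** (GalerkinLimit.lean:52–53; proved in
the artefact from `chainNormProduct_le`, resting on the numeric axioms listed at `FiniteTypeData`) — as a Step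
over the parameter. [claim: StrelzoffStrelzoff2026NSHopf, status: under-review] -/
def Step_uniformChainContractivity (F : FiniteTypeData) : Prop := F.UniformChainContractivity

/-- **The TYPE of `finiteType_regularity`** (GalerkinLimit.lean:75–86; docstring: «Main theorem. Every
ℝ³-admissible initial datum yields a globally smooth solution … a single result of the form expected by the
Clay Millennium Problem»): `(u₀ : R3VelocityField) (C₀ : ℝ) (hC₀ : 0 < C₀) : ∃ u, isGlobalSmoothSolution u`.
[claim: StrelzoffStrelzoff2026NSHopf, status: under-review] -/
def FiniteTypeCapstone (F : FiniteTypeData) : Prop :=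
  ∀ (_u₀ : F.V) (C₀ : ℝ), 0 < C₀ → ∃ u : F.V, F.isGlobalSmoothSolution u

/-- The artefact's 3-line proof of `finiteType_regularity`, re-run over the parameters: the two axioms and
uniform chain contractivity give the capstone. [cite: StrelzoffStrelzoff2026NSHopf, Spectral/FiniteType/GalerkinLimit.lean:75–86] -/
theorem finiteTypeCapstone_of_axioms (F : FiniteTypeData) (hgc : Axiom_galerkinCompactness F)
    (hne : Axiom_nielsenCriticalEstimate F) (hucc : Step_uniformChainContractivity F) :
    FiniteTypeCapstone F := by
  intro u₀ C₀ hC₀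
  obtain ⟨u, C, hC, hb⟩ := hgc u₀ C₀ hC₀ hucc
  exact ⟨u, hne u C hC hb⟩

/-- **Kernel fact: what `finiteType_regularity` says.** Its conclusion does not mention `u₀` (nor `ν`, nor an
equation): the statement is equivalent to "if the opaque type is inhabited, some element satisfies the
uninterpreted predicate `isGlobalSmoothSolution`". [cite: StrelzoffStrelzoff2026NSHopf, Spectral/FiniteType/GalerkinLimit.lean:75–86] -/
theorem finiteTypeCapstone_iff (F : FiniteTypeData) :
    FiniteTypeCapstone F ↔ (Nonempty F.V → ∃ u : F.V, F.isGlobalSmoothSolution u) := by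
  constructor
  · rintro h ⟨u₀⟩
    exact h u₀ 1 one_pos
  · intro h u₀ C₀ _
    exact h ⟨u₀⟩

/-- **The v2 bridge** (GalerkinLimit.lean:75 docstring «of the form expected by the Clay Millennium Problem»;
md Abstract l.26–28 «v2 adds … `Spectral/FiniteType/`»): the supplement's capstone, for whatever
interpretation of its symbols the deposit intends, ⇒ the abstract's sentence. No dictionary from
`R3VelocityField`/`isGlobalSmoothSolution` to velocity fields / solutions is given in the deposit
(`stereographic_solvesNS_iff (u) : Prop` is itself an axiomatised constant, Stereographic.lean:69–75).
[claim: StrelzoffStrelzoff2026NSHopf, status: under-review] -/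
def Step_bridgeFT (F : FiniteTypeData) : Prop :=
  FiniteTypeCapstone F → ClaimedTheorem

/-- **COMPOSITION (v2 supplement)**: the two NS-carrying axioms, uniform chain contractivity and the v2
bridge imply the claim. Pure logic. [claim: StrelzoffStrelzoff2026NSHopf, status: under-review] -/
theorem claim_of_steps_v2 (F : FiniteTypeData) (hgc : Axiom_galerkinCompactness F)
    (hne : Axiom_nielsenCriticalEstimate F) (hucc : Step_uniformChainContractivity F)
    (hbr : Step_bridgeFT F) : ClaimedTheorem :=
  hbr (finiteTypeCapstone_of_axioms F hgc hne hucc)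

/-- With a ONE-POINT carrier and the always-true predicate the v2 capstone and both axioms hold trivially —
kernel record that, as typed in the deposit, they constrain nothing (the bridge `Step_bridgeFT` for that `F`
is again equivalent to `ClaimedTheorem`). [cite: StrelzoffStrelzoff2026NSHopf, Spectral/FiniteType/GalerkinLimit.lean:60–86] -/
theorem finiteType_trivial_model :
    let F : FiniteTypeData := ⟨Unit, fun _ _ => 0, fun _ => True, True⟩
    FiniteTypeCapstone F ∧ Axiom_galerkinCompactness F ∧ Axiom_nielsenCriticalEstimate F ∧
      (Step_bridgeFT F ↔ ClaimedTheorem) := by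
  refine ⟨fun _ _ _ => ⟨(), trivial⟩, fun _ C₀ hC₀ _ => ⟨(), C₀, hC₀, fun _ _ => hC₀.le⟩,
    fun _ _ _ _ => trivial, ⟨fun h => h fun _ _ _ => ⟨(), trivial⟩, fun h _ => h⟩⟩

end

end Literature.Claims.NS.Strelzoff2026
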